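import Mathlib
import Literature.Analysis.FluidPDE.ClassicalSolutionGalilean
import HarnessLib.Audit

/-!
# Crux E `PowerGaugeEulerLiouville` (stmt-NavierStokesRegularity-19832): THE SIMILARITY BERNOULLI FUNCTION OF A GENERAL
# CLASSICAL EULER FLOW AND ITS PRESSURE-CLOCK DEFECT (physical variables; Lagrangian bookkeeping for the DSS key K-A″)

Route `EulerZoomLiouville` (NavierStokesRegularity), crux E, width seat ns-cas-k2 (g2), key K-A″ «sub-Bernoulli pressure clock».
For a classical Euler flow `(u, p)` on the past `(−∞, 0)`, a similarity exponent `n` (for Seregin's class `n = 1/(2+ρ)`), and a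
particle path `X` (`X' = u(s, X)`), put
`𝓑(s) := (−s)^{2−2n} · [ ½‖u‖² + p + n⟪X, u⟫/(−s) − ½ n(1−2n) ‖X‖²/(−s)² ](s, X(s))`
(in similarity variables `y = x/(−s)ⁿ`, `U = (−s)^{1−n} u`, `P = (−s)^{2−2n} p` this is CIV's self-similar Bernoulli function
`ℋ = ½|ny + U|² + P + ½ n(n−1)|y|²`).  The IDENTITY (no self-similarity assumed)
`𝓑'(s) = (−s)^{1−2n} · [ 𝒟p − (1−2n) ‖u + (n/(−s)) X‖² ](s, X(s))`,  `𝒟p := (−s) ∂ₛp − n ∂_X p − 2(1−n) p`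
(`𝒟p` = the self-similar defect of the pressure, `= 0` iff `p` is exactly self-similar with exponent `n`) is CIV's transport
identity `V·∇ℋ = (2γ−1)|V|²` plus the pressure-clock term.  Under the PRESSURE-CLOCK hypothesis `𝒟p ≤ θ(1−2n)‖u + (n/(−s))x‖²`,
`θ ≤ 1`, `n ≤ ½`, `𝓑` is non-increasing along every particle path, and for `θ < 1` the similarity speed is square-integrable
against the clock: `(1−θ)(1−2n) ∫_a^b (−s)^{1−2n} ‖u + (n/(−s))X‖² ds ≤ 𝓑(a) − 𝓑(b)`.

* `hasDerivAt_velocity_comp` / `hasDerivAt_pressure_comp` — material derivatives `D_t u = −∇p`, `D_t p = ∂ₜp + ∂_u p` along a path;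
* `hasDerivAt_similarityBernoulli` — the identity;
* `similarityBernoulli_antitoneOn` — monotonicity under the pressure clock;
* `integral_similaritySpeed_sq_le` — the budget;
* `tendsto_zero_atBot_of_deriv_le_of_integral_le` — a BARBALAT LEMMA against the logarithmic clock (pure real analysis, used by
  the companion `…SimilarityBernoulliRest`): `g ≥ 0` on `(−∞,b₀]`, `|g'| ≤ L/(−s)`, `∫_a^{b₀} g/(−s) ≤ M` for all `a` ⇒ `g → 0` at `−∞`.

WHAT THIS IS NOT: not NS regularity, not the crux E — Lagrangian bookkeeping for hypothetical blow-up members; nothing here is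
specific to Seregin's class. [cite: ConstantinIgnatovaVicol2026Putative, §3.4.3 (3.29)–(3.31) (the self-similar case)]
-/

noncomputable section

set_option linter.dupNamespace false

open MeasureTheory Set Filter Topology Metric Function
open scoped NNReal ENNReal ContDiff InnerProductSpace RealInnerProductSpace

namespace Summit.NavierStokesRegularity.NavierStokesRegularity.Theorems.PowerGaugeEulerLiouville.SimilarityBernoulli

open Literature.Analysis Literature.Analysis.FluidPDE Literature.Analysis.FunctionSpaces

variable {u : ℝ → EuclideanSpace ℝ (Fin 3) → EuclideanSpace ℝ (Fin 3)} {p : ℝ → EuclideanSpace ℝ (Fin 3) → ℝ}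
  {X : ℝ → EuclideanSpace ℝ (Fin 3)} {n θ : ℝ}

/-! ### Material derivatives along a particle path -/

/-- **`D_t u = −∇p` along a particle path** of a classical Euler flow on `(−∞,0)`. [folklore] -/
theorem hasDerivAt_velocity_comp (hcl : IsClassicalEulerSolutionOn (Iio 0) 0 u p) {t : ℝ} (ht : t < 0)
    (hX : HasDerivAt X (u t (X t)) t) :
    HasDerivAt (fun s => u s (X s)) (-gradient (p t) (X t)) t := by
  have h1 := hcl.smooth_velocity.hasDerivWithinAt_comp_curve (mem_Iio.2 ht) (uniqueDiffOn_Iio 0 t ht)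
    hX.hasDerivWithinAt
  have hmom := hcl.momentum t (mem_Iio.2 ht) (X t)
  rw [convect_apply, zero_smul, zero_sub] at hmom
  have e : timeDerivWithin (Iio 0) u t (X t) + fderiv ℝ (u t) (X t) (u t (X t)) = -gradient (p t) (X t) := by
    rw [hmom]; simp
  rw [e] at h1
  exact h1.hasDerivAt (Iio_mem_nhds ht)

/-- **`D_t p = ∂ₜp + ∂_u p` along a particle path** of a classical Euler flow on `(−∞,0)`. [folklore] -/
theorem hasDerivAt_pressure_comp (hcl : IsClassicalEulerSolutionOn (Iio 0) 0 u p) {t : ℝ} (ht : t < 0)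
    (hX : HasDerivAt X (u t (X t)) t) :
    HasDerivAt (fun s => p s (X s)) (timeDerivWithin (Iio 0) p t (X t) + fderiv ℝ (p t) (X t) (u t (X t))) t :=
  (hcl.smooth_pressure.hasDerivWithinAt_comp_curve (mem_Iio.2 ht) (uniqueDiffOn_Iio 0 t ht)
    hX.hasDerivWithinAt).hasDerivAt (Iio_mem_nhds ht)

/-! ### The identity -/

/-- **THE SIMILARITY-BERNOULLI IDENTITY** along a particle path of a classical Euler flow on `(−∞,0)` (any real `n`):
`d/ds { (−s)^{2−2n} [½‖u‖² + p + n⟪X,u⟫/(−s) − ½n(1−2n)‖X‖²/(−s)²] } = (−s)^{1−2n} [ 𝒟p − (1−2n)‖u + (n/(−s))X‖² ]`,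
`𝒟p = (−s)∂ₛp − n ∂_X p − 2(1−n)p`. [cite: ConstantinIgnatovaVicol2026Putative, §3.4.3 (3.31) (self-similar case `𝒟p = 0`)] -/
theorem hasDerivAt_similarityBernoulli (hcl : IsClassicalEulerSolutionOn (Iio 0) 0 u p) {t : ℝ} (ht : t < 0)
    (hX : HasDerivAt X (u t (X t)) t) :
    HasDerivAt (fun s => (-s) ^ (2 - 2 * n) *
        (‖u s (X s)‖ ^ 2 / 2 + p s (X s) + n * ⟪X s, u s (X s)⟫ / (-s) - n * (1 - 2 * n) / 2 * ‖X s‖ ^ 2 / (-s) ^ 2))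
      ((-t) ^ (1 - 2 * n) *
        (((-t) * timeDerivWithin (Iio 0) p t (X t) - n * fderiv ℝ (p t) (X t) (X t) - 2 * (1 - n) * p t (X t)) -
          (1 - 2 * n) * ‖u t (X t) + (n / (-t)) • X t‖ ^ 2)) t := by
  have ha : 0 < -t := by linarith
  have hane : (-t) ≠ 0 := ha.ne'
  have hU := hasDerivAt_velocity_comp hcl ht hX
  have hP := hasDerivAt_pressure_comp hcl ht hX
  have hneg : HasDerivAt (fun s : ℝ => -s) (-1) t := hasDerivAt_neg t
  -- the pieces
  have hUsq : HasDerivAt (fun s => ‖u s (X s)‖ ^ 2 / 2) (2 * ⟪u t (X t), -gradient (p t) (X t)⟫ / 2) t :=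
    hU.norm_sq.div_const 2
  have hI : HasDerivAt (fun s => ⟪X s, u s (X s)⟫) (⟪X t, -gradient (p t) (X t)⟫ + ⟪u t (X t), u t (X t)⟫) t :=
    hX.inner ℝ hU
  have hIr : HasDerivAt (fun s => n * ⟪X s, u s (X s)⟫ / (-s))
      ((n * (⟪X t, -gradient (p t) (X t)⟫ + ⟪u t (X t), u t (X t)⟫) * (-t) - n * ⟪X t, u t (X t)⟫ * (-1)) / (-t) ^ 2) t :=
    (hI.const_mul n).div hneg hane
  have hXsq : HasDerivAt (fun s => ‖X s‖ ^ 2) (2 * ⟪X t, u t (X t)⟫) t := hX.norm_sq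
  have hsq2 : HasDerivAt (fun s : ℝ => (-s) ^ 2) (2 * (-t) * (-1)) t := by
    have h := hneg.mul hneg
    have e : (fun s : ℝ => (-s) ^ 2) = fun s => (-s) * (-s) := by funext s; ring
    rw [e]
    exact h.congr_deriv (by ring)
  have hXr : HasDerivAt (fun s => n * (1 - 2 * n) / 2 * ‖X s‖ ^ 2 / (-s) ^ 2)
      ((n * (1 - 2 * n) / 2 * (2 * ⟪X t, u t (X t)⟫) * (-t) ^ 2 -
        n * (1 - 2 * n) / 2 * ‖X t‖ ^ 2 * (2 * (-t) * (-1))) / ((-t) ^ 2) ^ 2) t :=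
    (hXsq.const_mul _).div hsq2 (pow_ne_zero 2 hane)
  have hh := ((hUsq.add hP).add hIr).sub hXr
  have hw : HasDerivAt (fun s : ℝ => (-s) ^ (2 - 2 * n)) ((-1) * (2 - 2 * n) * (-t) ^ (2 - 2 * n - 1)) t :=
    hneg.rpow_const (Or.inl hane)
  have hall := hw.mul hh
  refine hall.congr_deriv ?_
  -- algebra
  have e1 : (-t) ^ (2 - 2 * n - 1) = (-t) ^ (1 - 2 * n) := by congr 1; ring
  have e2 : (-t) ^ (2 - 2 * n) = (-t) ^ (1 - 2 * n) * (-t) := by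
    rw [show (2 : ℝ) - 2 * n = (1 - 2 * n) + 1 by ring, Real.rpow_add_one hane]
  have e3 : ⟪u t (X t), -gradient (p t) (X t)⟫ = -(fderiv ℝ (p t) (X t) (u t (X t))) := by
    rw [inner_neg_right, real_inner_comm, gradient, InnerProductSpace.toDual_symm_apply]
  have e4 : ⟪X t, -gradient (p t) (X t)⟫ = -(fderiv ℝ (p t) (X t) (X t)) := by
    rw [inner_neg_right, real_inner_comm, gradient, InnerProductSpace.toDual_symm_apply]
  have e5 : ‖u t (X t) + (n / (-t)) • X t‖ ^ 2 =
      ‖u t (X t)‖ ^ 2 + 2 * (n / (-t)) * ⟪X t, u t (X t)⟫ + (n / (-t)) ^ 2 * ‖X t‖ ^ 2 := by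
    rw [norm_add_sq_real, inner_smul_right, real_inner_comm, norm_smul, mul_pow, Real.norm_eq_abs, sq_abs]
    ring
  have e6 : ⟪u t (X t), u t (X t)⟫ = ‖u t (X t)‖ ^ 2 := real_inner_self_eq_norm_sq _
  have htne : t ≠ 0 := ne_of_lt ht
  simp only [Pi.add_apply, Pi.sub_apply]
  rw [e1, e2, e3, e4, e6, e5]
  field_simp
  ring

/-! ### Monotonicity under the pressure clock, and the speed budget -/

/-- **THE PRESSURE CLOCK MAKES `𝓑` A LYAPUNOV FUNCTION**: if `𝒟p ≤ θ(1−2n)‖u + (n/(−s))x‖²` on `(−∞,0) × ℝ³` with `θ ≤ 1` and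
`n ≤ ½`, then along every particle path defined on `(−∞, 0)` the similarity Bernoulli function is non-increasing.
[cite: ConstantinIgnatovaVicol2026Putative, §3.4.3 (3.32) (self-similar case)] -/
theorem similarityBernoulli_antitoneOn (hcl : IsClassicalEulerSolutionOn (Iio 0) 0 u p) (hn : n ≤ 1 / 2) (hθ : θ ≤ 1)
    (hclock : ∀ s : ℝ, s < 0 → ∀ x : EuclideanSpace ℝ (Fin 3),
      (-s) * timeDerivWithin (Iio 0) p s x - n * fderiv ℝ (p s) x x - 2 * (1 - n) * p s x ≤
        θ * (1 - 2 * n) * ‖u s x + (n / (-s)) • x‖ ^ 2)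
    (hX : ∀ s : ℝ, s < 0 → HasDerivAt X (u s (X s)) s) :
    AntitoneOn (fun s => (-s) ^ (2 - 2 * n) *
        (‖u s (X s)‖ ^ 2 / 2 + p s (X s) + n * ⟪X s, u s (X s)⟫ / (-s) - n * (1 - 2 * n) / 2 * ‖X s‖ ^ 2 / (-s) ^ 2))
      (Iio 0) := by
  refine antitoneOn_of_hasDerivWithinAt_nonpos (convex_Iio 0)
    (fun s hs => (hasDerivAt_similarityBernoulli hcl hs (hX s hs)).continuousAt.continuousWithinAt)
    (fun s hs => by
      rw [interior_Iio] at hs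
      exact (hasDerivAt_similarityBernoulli hcl hs (hX s hs)).hasDerivWithinAt)
    fun s hs => ?_
  rw [interior_Iio] at hs
  have hs0 : s < 0 := hs
  have hpow : 0 ≤ (-s) ^ (1 - 2 * n) := Real.rpow_nonneg (by linarith) _
  refine mul_nonpos_of_nonneg_of_nonpos hpow ?_
  have h1 := hclock s hs0 (X s)
  have h2 : θ * (1 - 2 * n) * ‖u s (X s) + (n / (-s)) • X s‖ ^ 2 ≤ (1 - 2 * n) * ‖u s (X s) + (n / (-s)) • X s‖ ^ 2 := by
    have : 0 ≤ (1 - 2 * n) * ‖u s (X s) + (n / (-s)) • X s‖ ^ 2 := mul_nonneg (by linarith) (sq_nonneg _)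
    nlinarith
  linarith

/-- **THE SPEED BUDGET**: under the pressure clock (any real `θ`, `n`), along every particle path on `(−∞,0)` and for
`a ≤ b < 0`: `(1−θ)(1−2n) ∫_a^b (−s)^{1−2n} ‖u + (n/(−s))X‖² ds ≤ 𝓑(a) − 𝓑(b)` (useful when `θ < 1`, `n < ½`). [folklore] -/
theorem integral_similaritySpeed_sq_le (hcl : IsClassicalEulerSolutionOn (Iio 0) 0 u p)
    (hclock : ∀ s : ℝ, s < 0 → ∀ x : EuclideanSpace ℝ (Fin 3),
      (-s) * timeDerivWithin (Iio 0) p s x - n * fderiv ℝ (p s) x x - 2 * (1 - n) * p s x ≤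
        θ * (1 - 2 * n) * ‖u s x + (n / (-s)) • x‖ ^ 2)
    (hX : ∀ s : ℝ, s < 0 → HasDerivAt X (u s (X s)) s) {a b : ℝ} (hab : a ≤ b) (hb : b < 0) :
    (1 - θ) * (1 - 2 * n) * ∫ s in a..b, (-s) ^ (1 - 2 * n) * ‖u s (X s) + (n / (-s)) • X s‖ ^ 2 ≤
      (-a) ^ (2 - 2 * n) *
          (‖u a (X a)‖ ^ 2 / 2 + p a (X a) + n * ⟪X a, u a (X a)⟫ / (-a) - n * (1 - 2 * n) / 2 * ‖X a‖ ^ 2 / (-a) ^ 2) -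
        (-b) ^ (2 - 2 * n) *
          (‖u b (X b)‖ ^ 2 / 2 + p b (X b) + n * ⟪X b, u b (X b)⟫ / (-b) - n * (1 - 2 * n) / 2 * ‖X b‖ ^ 2 / (-b) ^ 2) := by
  have ha : a < 0 := lt_of_le_of_lt hab hb
  -- notation-free abbreviations
  set B : ℝ → ℝ := fun s => (-s) ^ (2 - 2 * n) *
      (‖u s (X s)‖ ^ 2 / 2 + p s (X s) + n * ⟪X s, u s (X s)⟫ / (-s) - n * (1 - 2 * n) / 2 * ‖X s‖ ^ 2 / (-s) ^ 2) with hB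
  set D : ℝ → ℝ := fun t => (-t) ^ (1 - 2 * n) *
      (((-t) * timeDerivWithin (Iio 0) p t (X t) - n * fderiv ℝ (p t) (X t) (X t) - 2 * (1 - n) * p t (X t)) -
        (1 - 2 * n) * ‖u t (X t) + (n / (-t)) • X t‖ ^ 2) with hD
  set g : ℝ → ℝ := fun s => (-s) ^ (1 - 2 * n) * ‖u s (X s) + (n / (-s)) • X s‖ ^ 2 with hg
  have hderiv : ∀ s ∈ uIcc a b, HasDerivAt B (D s) s := by
    intro s hs
    rw [uIcc_of_le hab] at hs
    exact hasDerivAt_similarityBernoulli hcl (lt_of_le_of_lt hs.2 hb) (hX s (lt_of_le_of_lt hs.2 hb))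
  have hIcc : Icc a b ⊆ Iio 0 := fun s hs => lt_of_le_of_lt hs.2 hb
  -- continuity of the integrands on `[a, b]`
  have hXc : ContinuousOn X (Icc a b) := fun s hs => (hX s (hIcc hs)).continuousAt.continuousWithinAt
  have hγ : ContinuousOn (fun s => ((s, X s) : ℝ × EuclideanSpace ℝ (Fin 3))) (Icc a b) :=
    continuousOn_id.prodMk hXc
  have hmaps : MapsTo (fun s => ((s, X s) : ℝ × EuclideanSpace ℝ (Fin 3))) (Icc a b) (Iio 0 ×ˢ univ) :=
    fun s hs => mk_mem_prod (hIcc hs) (mem_univ _)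
  have huc : ContinuousOn (fun s => u s (X s)) (Icc a b) :=
    hcl.smooth_velocity.continuousOn.comp hγ hmaps
  have hpc : ContinuousOn (fun s => p s (X s)) (Icc a b) :=
    hcl.smooth_pressure.continuousOn.comp hγ hmaps
  have hptc : ContinuousOn (fun s => timeDerivWithin (Iio 0) p s (X s)) (Icc a b) :=
    (hcl.smooth_pressure.timeDerivWithin (uniqueDiffOn_Iio 0)).continuousOn.comp hγ hmaps
  have hpDc : ContinuousOn (fun s => fderiv ℝ (p s) (X s) (X s)) (Icc a b) := by
    have h1 : ContinuousOn (fun s => fderiv ℝ (p s) (X s)) (Icc a b) :=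
      (hcl.smooth_pressure.fderiv_slice (uniqueDiffOn_Iio 0)).continuousOn.comp hγ hmaps
    exact h1.clm_apply hXc
  have hnegc : ContinuousOn (fun s : ℝ => -s) (Icc a b) := continuousOn_neg
  have hpowc : ∀ q : ℝ, ContinuousOn (fun s : ℝ => (-s) ^ q) (Icc a b) := fun q =>
    hnegc.rpow_const fun s hs => Or.inl (by have := hIcc hs; rw [mem_Iio] at this; linarith)
  have hWc : ContinuousOn (fun s => u s (X s) + (n / (-s)) • X s) (Icc a b) :=
    huc.add ((continuousOn_const.div hnegc fun s hs => by
      have := hIcc hs; rw [mem_Iio] at this; linarith).smul hXc)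
  have hgc : ContinuousOn g (Icc a b) := (hpowc _).mul (hWc.norm.pow 2)
  have hDc : ContinuousOn D (Icc a b) := by
    refine (hpowc _).mul ((((hnegc.mul hptc).sub (continuousOn_const.mul hpDc)).sub
      (continuousOn_const.mul hpc)).sub (continuousOn_const.mul (hWc.norm.pow 2)))
  have hDint : IntervalIntegrable D volume a b := (hDc.mono (by rw [uIcc_of_le hab])).intervalIntegrable
  have hgint : IntervalIntegrable g volume a b := (hgc.mono (by rw [uIcc_of_le hab])).intervalIntegrable
  -- FTC
  have hftc : ∫ s in a..b, D s = B b - B a :=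
    intervalIntegral.integral_eq_sub_of_hasDerivAt hderiv hDint
  -- pointwise: `D ≤ −(1−θ)(1−2n) g`
  have hle : ∀ s ∈ Icc a b, D s ≤ -((1 - θ) * (1 - 2 * n)) * g s := by
    intro s hs
    have hs0 : s < 0 := hIcc hs
    have hpow : 0 ≤ (-s) ^ (1 - 2 * n) := Real.rpow_nonneg (by linarith) _
    have h1 := hclock s hs0 (X s)
    simp only [hD, hg]
    have : ((-s) * timeDerivWithin (Iio 0) p s (X s) - n * fderiv ℝ (p s) (X s) (X s) - 2 * (1 - n) * p s (X s)) -
        (1 - 2 * n) * ‖u s (X s) + (n / (-s)) • X s‖ ^ 2 ≤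
        -((1 - θ) * (1 - 2 * n)) * ‖u s (X s) + (n / (-s)) • X s‖ ^ 2 := by linarith
    calc (-s) ^ (1 - 2 * n) * (((-s) * timeDerivWithin (Iio 0) p s (X s) - n * fderiv ℝ (p s) (X s) (X s) -
          2 * (1 - n) * p s (X s)) - (1 - 2 * n) * ‖u s (X s) + (n / (-s)) • X s‖ ^ 2)
        ≤ (-s) ^ (1 - 2 * n) * (-((1 - θ) * (1 - 2 * n)) * ‖u s (X s) + (n / (-s)) • X s‖ ^ 2) :=
          mul_le_mul_of_nonneg_left this hpow
      _ = -((1 - θ) * (1 - 2 * n)) * ((-s) ^ (1 - 2 * n) * ‖u s (X s) + (n / (-s)) • X s‖ ^ 2) := by ring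
  have hmono : ∫ s in a..b, D s ≤ ∫ s in a..b, -((1 - θ) * (1 - 2 * n)) * g s :=
    intervalIntegral.integral_mono_on hab hDint (hgint.const_mul _) hle
  rw [intervalIntegral.integral_const_mul, hftc] at hmono
  show (1 - θ) * (1 - 2 * n) * ∫ s in a..b, g s ≤ B a - B b
  linarith

/-! ### A Barbalat lemma against the logarithmic clock -/

/-- **BARBALAT AGAINST THE CLOCK `ds/(−s)`**: `g ≥ 0` differentiable on `(−∞, b₀]`, `b₀ < 0`, with `|g'(s)| ≤ L/(−s)` and
`∫_a^{b₀} g(s)/(−s) ds ≤ M` for every `a ≤ b₀` ⇒ `g → 0` at `−∞`. [folklore] -/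
theorem tendsto_zero_atBot_of_deriv_le_of_integral_le {g g' : ℝ → ℝ} {b₀ L M : ℝ} (hb₀ : b₀ < 0)
    (hg : ∀ s, s ≤ b₀ → HasDerivAt g (g' s) s) (hg' : ∀ s, s ≤ b₀ → |g' s| ≤ L / (-s))
    (hg0 : ∀ s, s ≤ b₀ → 0 ≤ g s) (hint : ∀ a, a ≤ b₀ → ∫ s in a..b₀, g s / (-s) ≤ M) :
    Tendsto g atBot (𝓝 0) := by
  have hL : 0 ≤ L := by
    have h := hg' b₀ le_rfl
    have hb : 0 < -b₀ := by linarith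
    by_contra hneg
    push Not at hneg
    have : L / (-b₀) < 0 := div_neg_of_neg_of_pos hneg hb
    linarith [abs_nonneg (g' b₀)]
  -- continuity and integrability
  have hgc : ContinuousOn g (Iic b₀) := fun s hs => (hg s hs).continuousAt.continuousWithinAt
  have hquot : ∀ a, a ≤ b₀ → IntervalIntegrable (fun s => g s / (-s)) volume a b₀ := by
    intro a ha
    refine ContinuousOn.intervalIntegrable ?_
    rw [uIcc_of_le ha]
    refine (hgc.mono fun s hs => hs.2).div continuousOn_neg fun s hs => ?_
    have : s ≤ b₀ := hs.2
    linarith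
  have hquot' : ∀ a b, a ≤ b → b ≤ b₀ → IntervalIntegrable (fun s => g s / (-s)) volume a b := by
    intro a b hab hb
    exact (hquot a (hab.trans hb)).mono_set (by
      rw [uIcc_of_le hab, uIcc_of_le (hab.trans hb)]; exact Icc_subset_Icc_right hb)
  -- the tail functional `S a = ∫_a^{b₀} g/(-s)` is antitone and bounded
  set S : ℝ → ℝ := fun a => ∫ s in a..b₀, g s / (-s) with hS
  have hSsplit : ∀ a a', a ≤ a' → a' ≤ b₀ → S a = (∫ s in a..a', g s / (-s)) + S a' := by
    intro a a' h1 h2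
    simp only [hS]
    rw [intervalIntegral.integral_add_adjacent_intervals (hquot' a a' h1 h2) (hquot a' h2)]
  have hpos : ∀ a a', a ≤ a' → a' ≤ b₀ → 0 ≤ ∫ s in a..a', g s / (-s) := by
    intro a a' h1 h2
    refine intervalIntegral.integral_nonneg h1 fun s hs => ?_
    have hs' : s ≤ b₀ := hs.2.trans h2
    exact div_nonneg (hg0 s hs') (by linarith)
  rw [Metric.tendsto_nhds]
  intro ε hε
  rw [eventually_atBot]
  by_contra H
  push Not at H
  -- constants
  set δ : ℝ := ε / (2 * (L + 1)) with hδ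
  have hδpos : 0 < δ := by positivity
  have hLδ : L * δ ≤ ε / 2 := by
    rw [hδ]
    rw [show L * (ε / (2 * (L + 1))) = (ε / 2) * (L / (L + 1)) by field_simp]
    have : L / (L + 1) ≤ 1 := by rw [div_le_one (by linarith)]; linarith
    nlinarith
  set c₀ : ℝ := ε / 2 * (δ / (1 + δ)) with hc₀
  have hc₀pos : 0 < c₀ := by positivity
  -- the supremum of the tails
  have hbdd : BddAbove (S '' Iic b₀) := ⟨M, by rintro _ ⟨a, ha, rfl⟩; exact hint a ha⟩
  have hne : (S '' Iic b₀).Nonempty := ⟨S b₀, b₀, mem_Iic.2 le_rfl, rfl⟩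
  obtain ⟨_, ⟨a₀, ha₀, rfl⟩, hlt⟩ := exists_lt_of_lt_csSup hne (sub_lt_self (sSup (S '' Iic b₀)) hc₀pos)
  -- a bad point `x ≤ a₀` with `g x ≥ ε`
  obtain ⟨x, hxa₀, hgx⟩ := H a₀
  have hxb₀ : x ≤ b₀ := hxa₀.trans ha₀
  have hx0 : 0 < -x := by linarith
  have hxne : x ≠ 0 := ne_of_lt (by linarith)
  rw [Real.dist_eq, sub_zero, abs_of_nonneg (hg0 x hxb₀)] at hgx
  -- on `[x − δ(−x), x]` the function stays `≥ ε/2`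
  set x' : ℝ := x - δ * (-x) with hx'
  have hx'x : x' ≤ x := by rw [hx']; nlinarith
  have hx'0 : -x' = (-x) * (1 + δ) := by rw [hx']; ring
  have hlow : ∀ σ ∈ Icc x' x, ε / 2 ≤ g σ := by
    intro σ hσ
    have hσb : σ ≤ b₀ := hσ.2.trans hxb₀
    -- mean value on `[σ, x]`
    have hmv := norm_image_sub_le_of_norm_deriv_le_segment' (f := g) (f' := g') (a := σ) (b := x) (C := L / (-x))
      (fun r hr => (hg r (hr.2.trans hxb₀)).hasDerivWithinAt) (fun r hr => by
        have hr0 : 0 < -r := by linarith [hr.2, hx0]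
        have h1 := hg' r (hr.2.le.trans hxb₀)
        rw [Real.norm_eq_abs]
        exact h1.trans (div_le_div_of_nonneg_left hL hx0 (by linarith [hr.2]))) x (right_mem_Icc.2 hσ.2)
    rw [Real.norm_eq_abs] at hmv
    have hlen : x - σ ≤ δ * (-x) := by have := hσ.1; rw [hx'] at this; linarith
    have h2 : L / (-x) * (x - σ) ≤ L * δ := by
      calc L / (-x) * (x - σ) ≤ L / (-x) * (δ * (-x)) := mul_le_mul_of_nonneg_left hlen (div_nonneg hL hx0.le)
        _ = L * δ := by field_simp
    have h3 : g x - g σ ≤ ε / 2 := ((le_abs_self _).trans hmv).trans (h2.trans hLδ)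
    linarith
  -- the integral over `[x', x]` is at least `c₀`
  have hchunk : c₀ ≤ ∫ s in x'..x, g s / (-s) := by
    have hconst : ∫ s in x'..x, (ε / 2) / (-x') = (x - x') * ((ε / 2) / (-x')) := by
      rw [intervalIntegral.integral_const, smul_eq_mul]
    have hle : ∫ s in x'..x, (ε / 2) / (-x') ≤ ∫ s in x'..x, g s / (-s) := by
      refine intervalIntegral.integral_mono_on hx'x (by simp) (hquot' x' x hx'x hxb₀) fun σ hσ => ?_
      have hσ0 : 0 < -σ := by linarith [hσ.2]
      have hx'pos : 0 < -x' := by rw [hx'0]; positivity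
      calc (ε / 2) / (-x') ≤ (ε / 2) / (-σ) := div_le_div_of_nonneg_left (by positivity) hσ0 (by linarith [hσ.1])
        _ ≤ g σ / (-σ) := div_le_div_of_nonneg_right (hlow σ hσ) hσ0.le
    rw [hconst] at hle
    have hval : (x - x') * ((ε / 2) / (-x')) = c₀ := by
      rw [hc₀, hx'0, show x - x' = δ * (-x) by rw [hx']; ring]
      field_simp
    linarith
  -- contradiction with the choice of `a₀`
  have hSx' : S x' = (∫ s in x'..a₀, g s / (-s)) + S a₀ := hSsplit x' a₀ (hx'x.trans hxa₀) ha₀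
  have hmid : ∫ s in x'..x, g s / (-s) ≤ ∫ s in x'..a₀, g s / (-s) := by
    rw [← intervalIntegral.integral_add_adjacent_intervals (hquot' x' x hx'x hxb₀) (hquot' x a₀ hxa₀ ha₀)]
    linarith [hpos x a₀ hxa₀ ha₀]
  have hle : S x' ≤ sSup (S '' Iic b₀) := le_csSup hbdd ⟨x', mem_Iic.2 (hx'x.trans hxb₀), rfl⟩
  linarith

end Summit.NavierStokesRegularity.NavierStokesRegularity.Theorems.PowerGaugeEulerLiouville.SimilarityBernoulli

end
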